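/-
Copyright (c) 2026. Released under the Apache 2.0 license.
-/
import Literature.NumberTheory.EllipticCurves.ManinConstantPlusPeriodCertificate
import Literature.NumberTheory.EllipticCurves.ManinConstantClassCertificatePlusPeriod
import HarnessLib

/-!
# Cremona's condition `(*)` VERBATIM (Agashe–Ribet–Stein 2006, appendix by J. E. Cremona, §5,
# p. 632 and the plus-space form in the proof of Thm. 5.4, p. 634), as a displayed per-class
# predicate `PlusPeriodTest W₁ ε`, and its FACT-FREE consequence `ClassAbsManinConstantEqOne`

Topic `Literature/NumberTheory/EllipticCurves`; namespace
`Literature.NumberTheory.EllipticCurves.ModularForms`. ONE predicate (a `def` with a free curve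
argument and a precision; nothing asserted) and THEOREMS only: no named fact (D-0014/D-0026).
Companion of `ManinConstantPlusPeriodCertificate.lean` (the plus-space criterion
`PlusPeriodClassBound W u ⇒ ClassAbsManinConstantEqOne W`, the print-to-tree dictionary and the page
locators of the held text `paper:doi-10-4310-pamq-2006-v2-n2-a11`), kept apart only for file size.
The predicate `PlusPeriodTest W₁ ε` is, by `Iff.rfl`, the predicate `IsPlusPeriodCloseWithin ε W₁`
of `ManinConstantClassCertificatePlusPeriod.lean` (which landed first and has priority as the name of
the verbatim datum; `plusPeriodTest_iff_isPlusPeriodCloseWithin` below records the identity, and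
`PlusPeriodTest.isPlusPeriodWindowCovered` / `IsPlusPeriodWindowCovered.plusPeriodTest` match the
printed-shape hypotheses): one story, two names.

## The print and its tree reading

Cremona, appendix §5 of Agashe–Ribet–Stein 2006. Condition `(*)` (p. 632 [p0016:L15–33]):
`|ω_{1,1}/ω_{1,f} − 1| < ε` for the normalised real generators of the Néron lattice `Λ₁` of the
reference curve `E₁` and of the period lattice `Λ_f`. Proof of Thm. 5.4 (p. 634 [p0018:L9–22]),
plus space only: "We do not know the lattice `Λ_f` but only (to a certain precision) a positive real
number `ω⁺_{1,f}` such that either `Λ_f` has type 1 and `ω_{1,f} = 2ω⁺_{1,f}`, or `Λ_f` has type 2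
and `ω_{1,f} = ω⁺_{1,f}` … the ratio `λ` … satisfies `|λ − 1| < ε`. In all cases this holds with
`ε = 1/3`, which will suffice." In the tree's normalisation (dictionary of the companion file:
`Ω(W) = realPeriodRat W = t · ω₁` with `t` the number of real components = Cremona's type;
`Ω⁺_f = plusPeriod f` with `re Λ_f = ℤ · Ω⁺_f/2`) the ratio is `λ = Ω(E₁)/Ω⁺_f` in both types, so
`(*)` is the statement `PlusPeriodTest W₁ ε := |Ω(W₁)/Ω⁺_f − 1| < ε` below, for the newform `f` of
`W₁`.

## What is proved

* `PlusPeriodTest.realPeriodRat_lt_two_mul`: `(*)` with `ε ≤ 1` (printed `ε = 1/3`) gives the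
  upper half `Ω(W₁) < 2 · Ω⁺_f` — all that the argument for `c = 1` uses.
* `PlusPeriodTest.plusPeriodClassBound_two`: `(*)` (`ε ≤ 1`) and `Ω(W') ≤ Ω(W₁)` for every
  globally minimal member `W'` of the class (Cremona's configurations "same type / type 1–2 with
  `a_j ≥ 2`", i.e. `Ω(E_j) = t_j ω_{1,1}/a_j ≤ t₁ ω_{1,1}`) give `PlusPeriodClassBound W₁ 2`.
* `PlusPeriodTest.classAbsManinConstantEqOne`: hence **`ClassAbsManinConstantEqOne W₁` — FACT-FREE**
  (no Manin-constant fact, no modularity fact, no optimality label), by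
  `classAbsManinConstantEqOne_of_plusPeriodClassBound_two`: the proof of Thm. 5.4, cases "same
  type" (`c = a_j = 1`) and "type 1/2" (`c = 1`, `a_j = 2`) [p0018:L23–31], for one class, with
  Cremona's datum displayed as printed.
The predicate is a DISPLAYED DATUM (one plus-space real period at level `N(W₁)` against the AGM
period of `W₁`); its attestation (refereed print for `N < 130000` [p0018:L19–22]; the database note
`manin.txt` ¶ "Optimality" beyond; or an independent two-implementation interval computation) is not
a matter for this file. HONEST FRAMING: typed ≠ proved ≠ endorsed; nothing here moves a class.

## References
* [AgasheRibetStein2006] A. Agashe, K. Ribet, W. A. Stein, *The Manin constant*, Pure Appl.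
  Math. Q. 2 (2006) 617–636; appendix §5 (J. E. Cremona): condition `(*)` p. 632, Prop. 5.1
  pp. 632–633, Thm. 5.4 and its proof p. 634.
* [CremonaAlgorithms1997] J. E. Cremona, *Algorithms for modular elliptic curves*, 2nd ed., CUP
  1997, §2.8 (the plus space and `re Λ_f`).
* [Cremona2022ManinConstants] J. E. Cremona, *Manin constants and optimal curves*,
  `ecdata/doc/manin.txt`.
-/

noncomputable section

open scoped MatrixGroups ModularForm

open CongruenceSubgroup WeierstrassCurve

namespace Literature.NumberTheory.EllipticCurves.ModularForms

/-- **Cremona's condition `(*)` for a reference model `W₁` with precision `ε`** (Agashe–Ribet–Stein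
2006, appendix §5, p. 632 `(*)`, read in the plus-space normalisation of the proof of Thm. 5.4,
p. 634: "the ratio `λ` … satisfies `|λ − 1| < ε`. In all cases this holds with `ε = 1/3`"), in the
tree's vocabulary `λ = Ω(W₁)/Ω⁺_f`: for the newform `f` of `W₁` (at whatever level it is written;
only the conductor, by multiplicity one), `|Ω(W₁)/Ω⁺_f − 1| < ε`. A PREDICATE (the displayed datum
of one plus-space run at level `N(W₁)`); nothing asserted.
[cite: AgasheRibetStein2006, appendix §5, (*) (p. 632) and proof of Thm. 5.4 (p. 634 L19–22)] -/
def PlusPeriodTest (W₁ : WeierstrassCurve ℚ) (ε : ℝ) : Prop :=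
  ∀ {N : ℕ} [NeZero N] (f : CuspForm (Gamma0 N) 2), IsNewformOf W₁ f →
    |W₁.realPeriodRat / plusPeriod f - 1| < ε

namespace PlusPeriodTest

variable {W₁ : WeierstrassCurve ℚ} {ε : ℝ}

/-- Monotonicity in the precision. [cite: AgasheRibetStein2006, appendix §5, (*) (p. 632)] -/
theorem mono (h : PlusPeriodTest W₁ ε) {ε' : ℝ} (hε : ε ≤ ε') : PlusPeriodTest W₁ ε' :=
  fun f hf ↦ (h f hf).trans_le hε

/-- **The upper half of `(*)`**: `(*)` with precision `ε ≤ 1` (Cremona: `ε = 1/3`) gives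
`Ω(W₁) < 2 · Ω⁺_f` for the newform of `W₁` — the hypothesis `hstar` of
`PlusPeriodClassBound.of_realPeriodRat_le_of_lt` /
`classAbsManinConstantEqOne_of_realPeriodRat_le_of_lt_two_mul` with `u = 2` (`Ω⁺_f > 0`,
`IsNewform0.plusPeriod_pos_holds`). [cite: AgasheRibetStein2006, appendix §5, proof of Thm. 5.4 (p. 634 L19–31)] -/
theorem realPeriodRat_lt_two_mul [W₁.IsElliptic] (h : PlusPeriodTest W₁ ε) (hε : ε ≤ 1)
    {N : ℕ} [NeZero N] (f : CuspForm (Gamma0 N) 2) (hf : IsNewformOf W₁ f) :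
    W₁.realPeriodRat < 2 * plusPeriod f := by
  have hplus : 0 < plusPeriod f := IsNewform0.plusPeriod_pos_holds hf.1 hf.coeffField_eq_bot
  have h1 : W₁.realPeriodRat / plusPeriod f - 1 < 1 :=
    ((abs_lt.mp (h f hf)).2).trans_le hε
  have h2 : W₁.realPeriodRat / plusPeriod f < 2 := by linarith
  exact (div_lt_iff₀ hplus).mp h2

/-- **`(*)` + Ω-maximality of the reference curve ⇒ the bound-`2` class test** (the printed
shape with the printed datum): `PlusPeriodTest W₁ ε` with `ε ≤ 1` and `Ω(W') ≤ Ω(W₁)` for every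
globally minimal member `W'` of the class give `PlusPeriodClassBound W₁ 2`.
[cite: AgasheRibetStein2006, appendix §5, (*) (p. 632) and proof of Thm. 5.4 (p. 634)] -/
theorem plusPeriodClassBound_two [W₁.IsElliptic] (h : PlusPeriodTest W₁ ε) (hε : ε ≤ 1)
    (hmax : ∀ (W' : WeierstrassCurve ℚ) [W'.IsElliptic] [W'.IsGloballyMinimal],
      IsIsogenous W₁ W' → W'.realPeriodRat ≤ W₁.realPeriodRat) :
    PlusPeriodClassBound W₁ 2 :=
  PlusPeriodClassBound.of_realPeriodRat_le_of_lt hmax fun f hf ↦ by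
    exact_mod_cast h.realPeriodRat_lt_two_mul hε f hf

/-- **Thm. 5.4's argument for one class, with Cremona's datum displayed verbatim — FACT-FREE**:
`(*)` for the reference minimal model `W₁` with precision `ε ≤ 1` (printed: `1/3`) and
`Ω(W') ≤ Ω(W₁)` for every globally minimal member of the class (configurations "same type /
type 1–2 with `a_j ≥ 2`") ⇒ `ClassAbsManinConstantEqOne W₁` (whichever member is optimal, its
Manin constant is `±1`). [cite: AgasheRibetStein2006, appendix §5, (*) (p. 632) and proof of Thm. 5.4 (p. 634 L19–31)] -/
theorem classAbsManinConstantEqOne [W₁.IsElliptic] (h : PlusPeriodTest W₁ ε) (hε : ε ≤ 1)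
    (hmax : ∀ (W' : WeierstrassCurve ℚ) [W'.IsElliptic] [W'.IsGloballyMinimal],
      IsIsogenous W₁ W' → W'.realPeriodRat ≤ W₁.realPeriodRat) :
    ClassAbsManinConstantEqOne W₁ :=
  classAbsManinConstantEqOne_of_plusPeriodClassBound_two W₁ (h.plusPeriodClassBound_two hε hmax)

/-- The same on a finite list (two legs, as in `PlusPeriodClassBound.of_finset_le_of_lt`): a
finite set `F` of globally minimal models meeting the `ℤ`-isomorphism class of every minimal member
(completeness of the class list), `Ω(V) ≤ Ω(W₁)` for every `V ∈ F`, and `(*)` for `W₁` with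
`ε ≤ 1` ⇒ `ClassAbsManinConstantEqOne W₁`, fact-free.
[cite: AgasheRibetStein2006, appendix §5, input (3) (p. 631 L24–25), (*) (p. 632) and proof of Thm. 5.4 (p. 634)] -/
theorem classAbsManinConstantEqOne_of_finset [W₁.IsElliptic] (h : PlusPeriodTest W₁ ε) (hε : ε ≤ 1)
    (F : Finset (WeierstrassCurve ℚ))
    (hF : ∀ (W' : WeierstrassCurve ℚ) [W'.IsElliptic] [W'.IsGloballyMinimal], IsIsogenous W₁ W' →
      ∃ C : VariableChange ℚ, (C • W').IsGloballyMinimal ∧ C • W' ∈ F)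
    (hmax : ∀ V ∈ F, V.realPeriodRat ≤ W₁.realPeriodRat) : ClassAbsManinConstantEqOne W₁ :=
  classAbsManinConstantEqOne_of_plusPeriodClassBound_two W₁
    (PlusPeriodClassBound.of_finset_le_of_lt F W₁ hF hmax fun f hf ↦ by
      exact_mod_cast h.realPeriodRat_lt_two_mul hε f hf)

end PlusPeriodTest

/-! ### One story, two names: `PlusPeriodTest W₁ ε` IS `IsPlusPeriodCloseWithin ε W₁`
(`ManinConstantClassCertificatePlusPeriod.lean`, landed first), and the printed-shape hypotheses
are `IsRealPeriodRatioLe 1` / `IsPlusPeriodWindowCovered` there -/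

/-- **The two renderings of Cremona's `(*)` coincide** (by `Iff.rfl`): `PlusPeriodTest W₁ ε` (this
file) and `IsPlusPeriodCloseWithin ε W₁` (`ManinConstantClassCertificatePlusPeriod.lean`, which has
priority) are the same proposition; cite either by name.
[cite: AgasheRibetStein2006, appendix §5, (*) (p. 632)] -/
theorem plusPeriodTest_iff_isPlusPeriodCloseWithin (W₁ : WeierstrassCurve ℚ) (ε : ℝ) :
    PlusPeriodTest W₁ ε ↔ IsPlusPeriodCloseWithin ε W₁ :=
  Iff.rfl

/-- The Ω-maximality hypothesis `hmax` of this file is `IsRealPeriodRatioLe 1 W₁` of the sibling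
(`r = 1`, `1 · Ω(W₁) = Ω(W₁)`). [cite: AgasheRibetStein2006, appendix §5, proof of Thm. 5.4 (p. 634 L23–44)] -/
theorem isRealPeriodRatioLe_one_iff (W₁ : WeierstrassCurve ℚ) :
    IsRealPeriodRatioLe 1 W₁ ↔
      ∀ (W' : WeierstrassCurve ℚ) [W'.IsElliptic] [W'.IsGloballyMinimal],
        IsIsogenous W₁ W' → W'.realPeriodRat ≤ W₁.realPeriodRat := by
  simp only [IsRealPeriodRatioLe, Rat.cast_one, one_mul]

/-- `(*)` with the printed `ε = 1/3` and Ω-maximality of `W₁` in its class are exactly the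
sibling's road predicate `IsPlusPeriodWindowCovered W₁`.
[cite: AgasheRibetStein2006, appendix Thm. 5.4 and its proof (p. 634)] -/
theorem PlusPeriodTest.isPlusPeriodWindowCovered {W₁ : WeierstrassCurve ℚ}
    (h : PlusPeriodTest W₁ (1 / 3))
    (hmax : ∀ (W' : WeierstrassCurve ℚ) [W'.IsElliptic] [W'.IsGloballyMinimal],
      IsIsogenous W₁ W' → W'.realPeriodRat ≤ W₁.realPeriodRat) :
    IsPlusPeriodWindowCovered W₁ :=
  ⟨h, (isRealPeriodRatioLe_one_iff W₁).mpr hmax⟩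

/-- Conversely, the sibling's road predicate gives `(*)` in this file's name and Ω-maximality.
[cite: AgasheRibetStein2006, appendix Thm. 5.4 and its proof (p. 634)] -/
theorem IsPlusPeriodWindowCovered.plusPeriodTest {W₁ : WeierstrassCurve ℚ}
    (h : IsPlusPeriodWindowCovered W₁) :
    PlusPeriodTest W₁ (1 / 3) ∧
      ∀ (W' : WeierstrassCurve ℚ) [W'.IsElliptic] [W'.IsGloballyMinimal],
        IsIsogenous W₁ W' → W'.realPeriodRat ≤ W₁.realPeriodRat :=
  ⟨h.1, (isRealPeriodRatioLe_one_iff W₁).mp h.2⟩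

end Literature.NumberTheory.EllipticCurves.ModularForms

end
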